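import Summits.CriticalPhenomena.CardyFormulaZ2.Theses.ModulusResponse
import Summits.CriticalPhenomena.CardyFormulaZ2.Theorems.ModulusResponseSegmentTransportExactOfForallApprox
import Summits.CriticalPhenomena.CardyFormulaZ2.Theorems.ModulusResponseSmirnovCellAnchor
import HarnessLib

/-!
# The kernel of line `birth` is equivalent to the crux `SegmentTransport` (stmt-CriticalPhenomena-11199)

Route `ModulusResponse` of `CriticalPhenomena/CardyFormulaZ2`, crux `SegmentTransport` (linear-image Cardy propagates
along the self-dual cell segment `μ_u`, `u ∈ [0,1/2]`), line `birth` (`Cruxes/SegmentTransport/Lines/birth.lean`).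
Notation: `P_u(t, R, δ) = (μ u).real (discreteCrossing (S t '' R.carrier) δ (S t '' R.arc 0) (S t '' R.arc 2))`,
`S_t z = cosh t · z + i sinh t · z̄` the pinned diagonal stretches, `F` = Cardy's function.

This file makes the line's end-state a theorem of the tree:

* `telescoping` — the abstract Euler-stepping bookkeeping of the skeleton (an approximation predicate that holds at
  `u = 0` for every tolerance and propagates by compensated steps of length `≤ Δ₀(η)` with first-order defect
  `η (u' - u) + s` holds at every `u ∈ [0,1/2]` for every tolerance).
* `compensation_of_universality` — for an ARBITRARY family of set functions `P u` (no probability): if every `u ∈ U`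
  has a stretch `τ(u)` making `P u ∘ S_{τ(u)}` exactly Cardy (`HasCrossingLimit`) on every conformal rectangle, then
  for all `u, u' ∈ U` ONE extra stretch `c = τ(u') - τ(u)` compensates the change `u → u'` simultaneously for all
  pre-stretches `t` and all conformal rectangles `R`, with defect ZERO:
  `limsup_{δ→0⁺} |P u' (S_{t+c} R, δ) - P u (S_t R, δ)| = 0` (image rectangle `S_{t-τ(u)} R` and the group law).
* `segmentTransport_of_uniformCompensation` — KERNEL ⇒ CRUX: the registered kernel stub `stub_uniformCompensation`
  of the line (δ-uniform first-order compensation: `∀ η > 0 ∃ Δ₀ > 0 ∀ 0 ≤ u ≤ u' ≤ u + Δ₀ ∃ c ∀ t R ε > 0, ∀ᶠ δ,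
  |P_{u'}(t + c, R, δ) - P_u(t, R, δ)| ≤ η (u' - u) + ε`, under the crux's cell-law, stretch, RSW and response
  antecedents), taken as a hypothesis, implies `SegmentTransport` (telescoping from the anchor, then the landed
  bootstrap `exact_of_forall_approx` = relative confinement p148123 + exactness upgrade p146443).
* `uniformCompensation_of_segmentTransport` — CRUX ⇒ KERNEL: conversely `SegmentTransport` implies the kernel
  statement outright, because the anchor antecedent of the crux is a theorem of the tree (`smirnovCellAnchor_proof`,
  `t₀ = -(log 3)/4`) and the conclusion of the crux feeds `compensation_of_universality` (`Δ₀ = 1`, defect `0`).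
* `uniformCompensation_iff_segmentTransport` — the two together: the line `birth` makes NO CUT in the open content of
  the crux; what it isolates (and what is now in the tree) is the conformal-geometry bootstrap. Any future line for this
  crux can import `compensation_of_universality` to check that its own kernel is implied by the conjectured conclusion.

References: Bollobás–Riordan, *Percolation on self-dual polygon configurations* (2010), p. 40 (the conclusion at
`u ∈ (0,1/2]` is an instance of their linear-image conjecture); Beffara, *Is critical 2D percolation universal?* (2008), §5.
-/

noncomputable section

open Set Filter Topology
open Literature.Probability.RandomPlanarGeometry

namespace Summit.CriticalPhenomena.CardyFormulaZ2.Cruxes.SegmentTransport.Birth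

/-- **Telescoping bookkeeping (abstract, proved).** An approximation predicate `A u t e` ("at parameter
`u` the stretch `t` is `e`-good") that is monotone in `e`, holds at `u = 0` for every `e > 0`, and propagates by
compensated steps of length `≤ Δ₀(η)` with first-order defect `η (u' - u) + s` (`s > 0` arbitrary), holds at
every `u ∈ [0,1/2]` for every `e > 0`: Euler stepping with `N` steps of length `u/N ≤ Δ₀(e/3)`, total error
`e/3 + (e/3) u + e/3 ≤ e`. -/
theorem telescoping {A : ℝ → ℝ → ℝ → Prop}
    (mono : ∀ u t e e', e ≤ e' → A u t e → A u t e')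
    (base : ∀ e : ℝ, 0 < e → ∃ t, A 0 t e)
    (step : ∀ η : ℝ, 0 < η → ∃ Δ₀ : ℝ, 0 < Δ₀ ∧ ∀ u ∈ Set.Icc (0 : ℝ) (1 / 2),
      ∀ u' ∈ Set.Icc (0 : ℝ) (1 / 2), u ≤ u' → u' ≤ u + Δ₀ →
        ∀ (t e : ℝ), A u t e → ∀ s : ℝ, 0 < s → ∃ t', A u' t' (e + η * (u' - u) + s)) :
    ∀ u ∈ Set.Icc (0 : ℝ) (1 / 2), ∀ e : ℝ, 0 < e → ∃ t, A u t e := by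
  intro u hu e he
  have transfer : ∀ {v v' t d d'}, A v t d → v = v' → d ≤ d' → A v' t d' := by
    rintro v v' t d d' h rfl hle
    exact mono v t d d' hle h
  obtain ⟨Δ₀, hΔ₀, hstep⟩ := step (e / 3) (by positivity)
  -- number of Euler steps `N ≥ 1` with `u / N ≤ Δ₀`
  obtain ⟨N, hN1, hNge⟩ : ∃ N : ℕ, (1 : ℝ) ≤ N ∧ u / Δ₀ ≤ N := by
    refine ⟨⌈u / Δ₀⌉₊ + 1, ?_, ?_⟩
    · push_cast
      linarith [(Nat.cast_nonneg (⌈u / Δ₀⌉₊) : (0 : ℝ) ≤ _)]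
    · push_cast
      linarith [Nat.le_ceil (u / Δ₀)]
  have hNpos : (0 : ℝ) < N := lt_of_lt_of_le one_pos hN1
  -- the step length `h = u / N`
  obtain ⟨h, hh0, hNh, hhΔ⟩ : ∃ h : ℝ, 0 ≤ h ∧ (N : ℝ) * h = u ∧ h ≤ Δ₀ := by
    refine ⟨u / N, div_nonneg hu.1 hNpos.le, by field_simp, ?_⟩
    rw [div_le_iff₀ hNpos]
    calc u = u / Δ₀ * Δ₀ := by field_simp
      _ ≤ N * Δ₀ := by gcongr
      _ = Δ₀ * N := mul_comm _ _
  have hjh : ∀ j : ℕ, j ≤ N → (j : ℝ) * h ∈ Set.Icc (0 : ℝ) (1 / 2) := by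
    intro j hj
    refine ⟨by positivity, ?_⟩
    calc (j : ℝ) * h ≤ N * h := mul_le_mul_of_nonneg_right (by exact_mod_cast hj) hh0
      _ = u := hNh
      _ ≤ 1 / 2 := hu.2
  -- the per-step slack `s` with `N s = e / 3`
  obtain ⟨s, hs0, hNs⟩ : ∃ s : ℝ, 0 < s ∧ (N : ℝ) * s = e / 3 :=
    ⟨e / 3 / N, by positivity, by field_simp⟩
  -- Euler stepping
  have key : ∀ j : ℕ, j ≤ N → ∃ t, A (j * h) t (e / 3 + j * (e / 3 * h + s)) := by
    intro j
    induction j with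
    | zero =>
      intro _
      obtain ⟨t, ht⟩ := base (e / 3) (by positivity)
      exact ⟨t, transfer ht (by simp) (by simp)⟩
    | succ j ih =>
      intro hj
      have hj' : j ≤ N := Nat.le_of_succ_le hj
      obtain ⟨t, ht⟩ := ih hj'
      have h1 : (j : ℝ) * h ≤ ((j : ℝ) + 1) * h := by nlinarith
      have h2 : ((j : ℝ) + 1) * h ≤ (j : ℝ) * h + Δ₀ := by nlinarith
      have mem2 : ((j : ℝ) + 1) * h ∈ Set.Icc (0 : ℝ) (1 / 2) := by
        have := hjh (j + 1) hj
        push_cast at this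
        exact this
      obtain ⟨t', ht'⟩ := hstep _ (hjh j hj') _ mem2 h1 h2 t _ ht s hs0
      exact ⟨t', transfer ht' (by push_cast; ring) (le_of_eq (by push_cast; ring))⟩
  obtain ⟨t, ht⟩ := key N le_rfl
  refine ⟨t, transfer ht hNh ?_⟩
  calc e / 3 + N * (e / 3 * h + s) = e / 3 + e / 3 * (N * h) + N * s := by ring
    _ = e / 3 + e / 3 * u + e / 3 := by rw [hNh, hNs]
    _ ≤ e := by nlinarith [hu.1, hu.2]

/-- **Exact linear-image universality on a parameter set gives compensation with defect zero** (pure bookkeeping, for an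
ARBITRARY family of set functions `P u : (Ω, δ, A, B) ↦ P u Ω δ A B`): if for every `u ∈ U` some stretch `τ(u)` makes
`δ ↦ P u (S_{τ(u)} R) δ` converge to `F(η(R))` for every conformal rectangle `R`, then for `u, u' ∈ U` the extra stretch
`c = τ(u') - τ(u)` gives `∀ᶠ δ → 0⁺, |P u' (S_{t+c} R) δ - P u (S_t R) δ| ≤ ε` for every `t`, `R`, `ε > 0`. Proof: both
terms are crossing numbers of the image rectangle `R' = S_{t-τ(u)}(R)` (group law `S_a ∘ S_b = S_{a+b}`:
`S_{τ(u)} R' = S_t R`, `S_{τ(u')} R' = S_{t+c} R`), so both converge to `F(η(R'))`. [folklore] -/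
theorem compensation_of_universality (P : ℝ → Set ℂ → ℝ → Set ℂ → Set ℂ → ℝ) (S : ℝ → ℂ → ℂ)
    (hS : ∀ t z, S t z = (Real.cosh t : ℂ) * z + Complex.I * (Real.sinh t : ℂ) * (starRingEnd ℂ) z)
    {U : Set ℝ}
    (huniv : ∀ u ∈ U, ∃ t : ℝ, ∀ R : ConformalRectangle,
      R.HasCrossingLimit (fun δ ↦ P u (S t '' R.carrier) δ (S t '' R.arc 0) (S t '' R.arc 2)) cardyFunction) :
    ∀ u ∈ U, ∀ u' ∈ U, ∃ c : ℝ, ∀ (t : ℝ) (R : ConformalRectangle) (ε : ℝ), 0 < ε →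
      ∀ᶠ δ in 𝓝[>] (0 : ℝ),
        |P u' (S (t + c) '' R.carrier) δ (S (t + c) '' R.arc 0) (S (t + c) '' R.arc 2) -
          P u (S t '' R.carrier) δ (S t '' R.arc 0) (S t '' R.arc 2)| ≤ ε := by
  intro u hu u' hu'
  obtain ⟨τ, hτ⟩ := huniv u hu
  obtain ⟨τ', hτ'⟩ := huniv u' hu'
  refine ⟨τ' - τ, fun t R ε hε ↦ ?_⟩
  -- the image rectangle `R' = S_{t-τ}(R)` and one uniformizing datum of it
  obtain ⟨h, hh⟩ := Exact.exists_stretchHomeomorph S hS (t - τ)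
  obtain ⟨ψ, y, hψ⟩ := MarkedDomain.exists_isUniformizing_holds (R.map h)
  have h1 := hτ (R.map h) ψ y hψ
  have h2 := hτ' (R.map h) ψ y hψ
  rw [Exact.image_carrier_map_stretch S hS R hh, Exact.image_arc_map_stretch S hS R hh,
    Exact.image_arc_map_stretch S hS R hh] at h1 h2
  have e1 : τ + (t - τ) = t := by ring
  have e2 : τ' + (t - τ) = t + (τ' - τ) := by ring
  rw [e1] at h1
  rw [e2] at h2
  have h3 := h2.sub h1
  rw [sub_self] at h3
  filter_upwards [(Metric.tendsto_nhds.1 h3) ε hε] with δ hδ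
  rw [Real.dist_eq, sub_zero] at hδ
  exact hδ.le

/-- **KERNEL ⇒ CRUX** (the skeleton's `SegmentTransport_of` with the registered kernel stub `stub_uniformCompensation`
of line `birth` bound as a hypothesis): δ-uniform first-order compensation along the segment implies
`ModulusResponse.SegmentTransport`. Telescoping from the anchor at `u = 0` gives, at every `u ∈ [0,1/2]`, stretches
that are `ε`-approximately linear-image Cardy for every `ε > 0`; `exact_of_forall_approx` (relative confinement +
Bolzano–Weierstrass + Radó) upgrades to an exact crossing limit. [folklore] -/
theorem segmentTransport_of_uniformCompensation
    (hK : ∀ (μ : ℝ → MeasureTheory.Measure (Literature.Probability.Percolation.BondConfig (Literature.Probability.LatticeModels.Site 2))) (S : ℝ → ℂ → ℂ), (∀ u, μ u = MeasureTheory.Measure.map (fun p : Set (Literature.Probability.LatticeModels.Site 2) × Set (Literature.Probability.LatticeModels.Site 2) ↦ {e | ∃ m, (m ∈ p.1 ∧ e = s(m - Pi.single 0 1, m)) ∨ ((m ∈ p.1 ↔ m ∉ p.2) ∧ e = s(m - Pi.single 1 1, m))}) ((ProbabilityTheory.setBernoulli Set.univ Literature.Probability.Percolation.half).prod (ProbabilityTheory.setBernoulli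 Set.univ (Set.projIcc 0 1 zero_le_one u)))) → (∀ t z, S t z = (Real.cosh t : ℂ) * z + Complex.I * (Real.sinh t : ℂ) * (starRingEnd ℂ) z) → (∃ c : ℝ, 0 < c ∧ ∀ u ∈ Set.Icc (0 : ℝ) (1 / 2), ∀ n : ℕ, 1 ≤ n → c ≤ (μ u).real (Literature.Probability.Percolation.lrCrossing (2 * n) n) ∧ c ≤ (μ u).real (Literature.Probability.Percolation.tbCrossing n (2 * n))) → (∃ k : ℝ, ∀ (R : Literature.Probability.RandomPlanarGeometry.ConformalRectangle) (t L : ℝ), HasDerivAt (fun s : ℝ ↦ Filter.limUnder (nhdsWithin (0 : ℝ) (Set.Ioi 0)) (fun δ ↦ (μ 0).real (Literature.Probability.Percolation.discreteCrossing (S s '' R.carrier) δ (S s '' R.arc 0) (S s '' R.arc 2)))) L t → Filter.Tendsto (fun δ ↦ derivWithin (fun u ↦ (μ u).real (Literature.Probability.Percolation.discreteCrossing (S t '' R.carrier) δ (S t '' R.arc 0) (S t '' R.arc 2))) (Set.Ici 0) 0) (nhdsWithin 0 (Set.Ioi 0)) (nhds (k * L))) → ∀ η : ℝ, 0 < η →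 ∃ Δ₀ : ℝ, 0 < Δ₀ ∧ ∀ u ∈ Set.Icc (0 : ℝ) (1 / 2), ∀ u' ∈ Set.Icc (0 : ℝ) (1 / 2), u ≤ u' → u' ≤ u + Δ₀ → ∃ c : ℝ, ∀ (t : ℝ) (R : Literature.Probability.RandomPlanarGeometry.ConformalRectangle) (ε : ℝ), 0 < ε → ∀ᶠ δ in nhdsWithin (0 : ℝ) (Set.Ioi 0), |(μ u').real (Literature.Probability.Percolation.discreteCrossing (S (t + c) '' R.carrier) δ (S (t + c) '' R.arc 0) (S (t + c) '' R.arc 2)) - (μ u).real (Literature.Probability.Percolation.discreteCrossing (S t '' R.carrier) δ (S t '' R.arc 0) (S t '' R.arc 2))| ≤ η * (u' - u) + ε) :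
    Summit.CriticalPhenomena.CardyFormulaZ2.Theses.ModulusResponse.SegmentTransport := by
  intro μ S hμ hS hRSW hAnchor hResp u hu
  have hcomp := hK μ S hμ hS hRSW hResp
  -- ε-approximate linear-image Cardy at `u`, for every ε, by telescoping from the anchor
  have happrox : ∀ e : ℝ, 0 < e → ∃ t : ℝ,
      ∀ (R : Literature.Probability.RandomPlanarGeometry.ConformalRectangle)
        (φ : Literature.Probability.RandomPlanarGeometry.ConformalEquiv UpperHalfPlane.upperHalfPlaneSet R.carrier)
        (x : Fin 4 → ℝ), R.IsUniformizing φ x → ∀ᶠ δ in nhdsWithin (0 : ℝ) (Set.Ioi 0),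
          |(μ u).real (Literature.Probability.Percolation.discreteCrossing (S t '' R.carrier) δ
              (S t '' R.arc 0) (S t '' R.arc 2)) -
            Literature.Probability.RandomPlanarGeometry.cardyFunction
              (Literature.Probability.RandomPlanarGeometry.crossRatio x)| ≤ e := by
    refine telescoping (A := fun u t e ↦
      ∀ (R : Literature.Probability.RandomPlanarGeometry.ConformalRectangle)
        (φ : Literature.Probability.RandomPlanarGeometry.ConformalEquiv UpperHalfPlane.upperHalfPlaneSet R.carrier)
        (x : Fin 4 → ℝ), R.IsUniformizing φ x → ∀ᶠ δ in nhdsWithin (0 : ℝ) (Set.Ioi 0),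
          |(μ u).real (Literature.Probability.Percolation.discreteCrossing (S t '' R.carrier) δ
              (S t '' R.arc 0) (S t '' R.arc 2)) -
            Literature.Probability.RandomPlanarGeometry.cardyFunction
              (Literature.Probability.RandomPlanarGeometry.crossRatio x)| ≤ e) ?_ ?_ ?_ u hu
    · -- monotone in the error
      intro v t d d' hle hA R φ x hux
      exact (hA R φ x hux).mono fun δ hδ ↦ hδ.trans hle
    · -- base: the anchor at `u = 0`
      intro d hd
      obtain ⟨t₀, ht₀⟩ := hAnchor
      refine ⟨t₀, fun R φ x hux ↦ ?_⟩
      have hlim := Metric.tendsto_nhds.1 (ht₀ R φ x hux) d hd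
      exact hlim.mono fun δ hδ ↦ by
        rw [Real.dist_eq] at hδ
        exact hδ.le
    · -- step: uniform compensation + triangle inequality
      intro η hη
      obtain ⟨Δ₀, hΔ₀, hc⟩ := hcomp η hη
      refine ⟨Δ₀, hΔ₀, ?_⟩
      intro v hv v' hv' hvv' hv'Δ t d hA s hs
      obtain ⟨c, hc⟩ := hc v hv v' hv' hvv' hv'Δ
      refine ⟨t + c, fun R φ x hux ↦ ?_⟩
      filter_upwards [hA R φ x hux, hc t R s hs] with δ hδ1 hδ2
      calc _ ≤ |(μ v').real (Literature.Probability.Percolation.discreteCrossing (S (t + c) '' R.carrier) δ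
                  (S (t + c) '' R.arc 0) (S (t + c) '' R.arc 2)) -
                (μ v).real (Literature.Probability.Percolation.discreteCrossing (S t '' R.carrier) δ
                  (S t '' R.arc 0) (S t '' R.arc 2))| +
              |(μ v).real (Literature.Probability.Percolation.discreteCrossing (S t '' R.carrier) δ
                  (S t '' R.arc 0) (S t '' R.arc 2)) -
                Literature.Probability.RandomPlanarGeometry.cardyFunction
                  (Literature.Probability.RandomPlanarGeometry.crossRatio x)| := abs_sub_le _ _ _
        _ ≤ (η * (v' - v) + s) + d := add_le_add hδ2 hδ1
        _ = d + η * (v' - v) + s := by ring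
  -- the landed bootstrap: approximate for every tolerance ⇒ exact
  exact exact_of_forall_approx
    (fun Ω δ A B ↦ (μ u).real (Literature.Probability.Percolation.discreteCrossing Ω δ A B)) S hS happrox

/-- **CRUX ⇒ KERNEL**: `ModulusResponse.SegmentTransport` implies the registered kernel stub of line `birth`
outright. The cell law pins `μ`, so the crux's anchor antecedent is supplied by the tree's `smirnovCellAnchor_proof`
(`t₀ = -(log 3)/4`); the crux's conclusion (a Cardy stretch `τ(u)` at every `u ∈ [0,1/2]`) then gives compensation
with `Δ₀ = 1`, `c = τ(u') - τ(u)` and defect `0 ≤ η (u' - u)` (`compensation_of_universality`). Hence the kernel is not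
easier than the crux: the line isolates the conformal-geometry bootstrap, nothing of the open content. [folklore] -/
theorem uniformCompensation_of_segmentTransport
    (hT : Summit.CriticalPhenomena.CardyFormulaZ2.Theses.ModulusResponse.SegmentTransport) :
    ∀ (μ : ℝ → MeasureTheory.Measure (Literature.Probability.Percolation.BondConfig (Literature.Probability.LatticeModels.Site 2))) (S : ℝ → ℂ → ℂ), (∀ u, μ u = MeasureTheory.Measure.map (fun p : Set (Literature.Probability.LatticeModels.Site 2) × Set (Literature.Probability.LatticeModels.Site 2) ↦ {e | ∃ m, (m ∈ p.1 ∧ e = s(m - Pi.single 0 1, m)) ∨ ((m ∈ p.1 ↔ m ∉ p.2) ∧ e = s(m - Pi.single 1 1, m))}) ((ProbabilityTheory.setBernoulli Set.univ Literature.Probability.Percolation.half).prod (ProbabilityTheory.setBernoulli Set.univ (Set.projIcc 0 1 zero_le_one u)))) → (∀ t z, S t z = (Real.cosh t : ℂ) * z + Complex.I * (Real.sinh t : ℂ) * (starRingEnd ℂ) z) → (∃ c : ℝ, 0 < c ∧ ∀ u ∈ Set.Icc (0 : ℝ) (1 / 2), ∀ n : ℕ, 1 ≤ n → c ≤ (μ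 u).real (Literature.Probability.Percolation.lrCrossing (2 * n) n) ∧ c ≤ (μ u).real (Literature.Probability.Percolation.tbCrossing n (2 * n))) → (∃ k : ℝ, ∀ (R : Literature.Probability.RandomPlanarGeometry.ConformalRectangle) (t L : ℝ), HasDerivAt (fun s : ℝ ↦ Filter.limUnder (nhdsWithin (0 : ℝ) (Set.Ioi 0)) (fun δ ↦ (μ 0).real (Literature.Probability.Percolation.discreteCrossing (S s '' R.carrier) δ (S s '' R.arc 0) (S s '' R.arc 2)))) L t → Filter.Tendsto (fun δ ↦ derivWithin (fun u ↦ (μ u).real (Literature.Probability.Percolation.discreteCrossing (S t '' R.carrier) δ (S t '' R.arc 0) (S t '' R.arc 2))) (Set.Ici 0) 0) (nhdsWithin 0 (Set.Ioi 0)) (nhds (k * L))) → ∀ η : ℝ, 0 < η → ∃ Δ₀ : ℝ, 0 < Δ₀ ∧ ∀ u ∈ Set.Icc (0 : ℝ) (1 / 2), ∀ u' ∈ Set.Icc (0 : ℝ) (1 / 2), u ≤ u' → u' ≤ u + Δ₀ → ∃ c : ℝ, ∀ (t : ℝ) (R : Literature.Probability.RandomPlanarGeometry.ConformalRectangle) (ε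 : ℝ), 0 < ε → ∀ᶠ δ in nhdsWithin (0 : ℝ) (Set.Ioi 0), |(μ u').real (Literature.Probability.Percolation.discreteCrossing (S (t + c) '' R.carrier) δ (S (t + c) '' R.arc 0) (S (t + c) '' R.arc 2)) - (μ u).real (Literature.Probability.Percolation.discreteCrossing (S t '' R.carrier) δ (S t '' R.arc 0) (S t '' R.arc 2))| ≤ η * (u' - u) + ε := by
  intro μ S hμ hS hRSW hResp η hη
  have hAnchor : ∃ t : ℝ, ∀ R : Literature.Probability.RandomPlanarGeometry.ConformalRectangle,
      R.HasCrossingLimit (fun δ ↦ (μ 0).real (Literature.Probability.Percolation.discreteCrossing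
        (S t '' R.carrier) δ (S t '' R.arc 0) (S t '' R.arc 2)))
        Literature.Probability.RandomPlanarGeometry.cardyFunction :=
    ⟨-(Real.log 3) / 4, Summit.CriticalPhenomena.CardyFormulaZ2.Theorems.smirnovCellAnchor_proof μ S hμ hS⟩
  have huniv := hT μ S hμ hS hRSW hAnchor hResp
  refine ⟨1, one_pos, ?_⟩
  intro u hu u' hu' huu' _
  obtain ⟨c, hc⟩ := compensation_of_universality
    (fun v Ω δ A B ↦ (μ v).real (Literature.Probability.Percolation.discreteCrossing Ω δ A B)) S hS huniv u hu u' hu'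
  refine ⟨c, fun t R ε hε ↦ (hc t R ε hε).mono fun δ hδ ↦ ?_⟩
  exact hδ.trans (le_add_of_nonneg_left (mul_nonneg hη.le (sub_nonneg.2 huu')))

/-- **The kernel of line `birth` is equivalent to the crux**: `stub_uniformCompensation`'s registered statement holds
iff `ModulusResponse.SegmentTransport` does. (So the one open stub of the line is exactly crux-sized: its truth at
`u ∈ (0,1/2]` is the Bollobás–Riordan linear-image conjecture for the self-dual cell family, and a proof of either
side is a proof of the other by the two maps above.) [folklore] -/
theorem uniformCompensation_iff_segmentTransport :
    (∀ (μ : ℝ → MeasureTheory.Measure (Literature.Probability.Percolation.BondConfig (Literature.Probability.LatticeModels.Site 2))) (S : ℝ → ℂ → ℂ), (∀ u, μ u = MeasureTheory.Measure.map (fun p : Set (Literature.Probability.LatticeModels.Site 2) × Set (Literature.Probability.LatticeModels.Site 2) ↦ {e | ∃ m, (m ∈ p.1 ∧ e = s(m - Pi.single 0 1, m)) ∨ ((m ∈ p.1 ↔ m ∉ p.2) ∧ e = s(m - Pi.single 1 1, m))}) ((ProbabilityTheory.setBernoulli Set.univ Literature.Probability.Percolation.half).prod (ProbabilityTheory.setBernoulli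 Set.univ (Set.projIcc 0 1 zero_le_one u)))) → (∀ t z, S t z = (Real.cosh t : ℂ) * z + Complex.I * (Real.sinh t : ℂ) * (starRingEnd ℂ) z) → (∃ c : ℝ, 0 < c ∧ ∀ u ∈ Set.Icc (0 : ℝ) (1 / 2), ∀ n : ℕ, 1 ≤ n → c ≤ (μ u).real (Literature.Probability.Percolation.lrCrossing (2 * n) n) ∧ c ≤ (μ u).real (Literature.Probability.Percolation.tbCrossing n (2 * n))) → (∃ k : ℝ, ∀ (R : Literature.Probability.RandomPlanarGeometry.ConformalRectangle) (t L : ℝ), HasDerivAt (fun s : ℝ ↦ Filter.limUnder (nhdsWithin (0 : ℝ) (Set.Ioi 0)) (fun δ ↦ (μ 0).real (Literature.Probability.Percolation.discreteCrossing (S s '' R.carrier) δ (S s '' R.arc 0) (S s '' R.arc 2)))) L t → Filter.Tendsto (fun δ ↦ derivWithin (fun u ↦ (μ u).real (Literature.Probability.Percolation.discreteCrossing (S t '' R.carrier) δ (S t '' R.arc 0) (S t '' R.arc 2))) (Set.Ici 0) 0) (nhdsWithin 0 (Set.Ioi 0)) (nhds (k * L))) → ∀ η : ℝ, 0 < η →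 ∃ Δ₀ : ℝ, 0 < Δ₀ ∧ ∀ u ∈ Set.Icc (0 : ℝ) (1 / 2), ∀ u' ∈ Set.Icc (0 : ℝ) (1 / 2), u ≤ u' → u' ≤ u + Δ₀ → ∃ c : ℝ, ∀ (t : ℝ) (R : Literature.Probability.RandomPlanarGeometry.ConformalRectangle) (ε : ℝ), 0 < ε → ∀ᶠ δ in nhdsWithin (0 : ℝ) (Set.Ioi 0), |(μ u').real (Literature.Probability.Percolation.discreteCrossing (S (t + c) '' R.carrier) δ (S (t + c) '' R.arc 0) (S (t + c) '' R.arc 2)) - (μ u).real (Literature.Probability.Percolation.discreteCrossing (S t '' R.carrier) δ (S t '' R.arc 0) (S t '' R.arc 2))| ≤ η * (u' - u) + ε) ↔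
      Summit.CriticalPhenomena.CardyFormulaZ2.Theses.ModulusResponse.SegmentTransport :=
  ⟨segmentTransport_of_uniformCompensation, uniformCompensation_of_segmentTransport⟩

end Summit.CriticalPhenomena.CardyFormulaZ2.Cruxes.SegmentTransport.Birth

end
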